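import Mathlib.MeasureTheory.Measure.Haar.InnerProductSpace
import Literature.Analysis.FluidPDE.IsometryInvariance
import Literature.Analysis.FluidPDE.DissipatesAtScale
import Summits.NavierStokesRegularity.NavierStokesRegularity.Theorems.SelfMixingDichotomyCoherentScaleExclusionHeatIsometry
import HarnessLib

/-!
# Crux `SelfMixingDichotomy.CoherentScaleExclusion` (stmt-NavierStokesRegularity-1423), line
  `registered`: stub INV2 `stub_dissipatesAtScale_isometry` — rotation/reflection covariance of
  the scalar dissipation factor `DissipatesAtScale` (the route's `MIX`)

Support file (`--supports stmt-NavierStokesRegularity-1423`) of the line lead c3. For a linear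
isometry `R` of `ℝ³` (rotation or reflection), a drift `u : ℝ → ℝ³ → ℝ³`, a final time `T`, a
centre `x₀`, a scale `r` and a factor `δ`,

  `DissipatesAtScale (R ∘ u ∘ R⁻¹) T (R x₀) r δ ↔ DissipatesAtScale u T x₀ r δ`,

where `(R ∘ u ∘ R⁻¹) t y = R (u t (R⁻¹ y))` is the conjugated drift: the functional `MIX` is
invariant under the isometry group of `ℝ³` acting simultaneously on the drift and on the centre of
the parabolic cylinder ("the functional is rotation invariant" in the route text).

Proof. One transfer lemma `mixIsometry_of_conj` for a general linear isometry `R`: if the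
conjugated drift dissipates at `(T, R x₁)`, then `v` dissipates at `(T, x₁)`. Given a scalar `θ`
admissible for `v` at `x₁` on the window `S = [T − r², T − r²/2]`, the composed scalar
`θ' t y := θ t (R⁻¹ y)` is admissible for the conjugated drift at `R x₁`:
* joint smoothness: `IsSmoothSpaceTimeOn.comp_linearIsometryEquiv_symm`;
* uniform rapid decay: `HeatIsometry.hasUniformRapidDecayOn_comp_linearIsometryEquiv_symm`
  (needs `UniqueDiffOn ℝ S`, i.e. `r ≠ 0`; at `r = 0` both sides hold outright by
  `dissipatesAtScale_zero_radius`);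
* equation: `∂ₜθ'(t, y) = ∂ₜθ(t, R⁻¹y)` (definitional), `∇θ'(y) = R ∇θ(R⁻¹ y)`
  (`gradient_comp_linearIsometryEquiv_symm`) so `⟪R v, R ∇θ⟫ = ⟪v, ∇θ⟫`
  (`LinearIsometryEquiv.inner_map_map`), and `Δθ'(y) = Δθ(R⁻¹ y)`
  (`laplacian_comp_linearIsometryEquiv_symm`);
* support: `support (θ' a) = R⁻¹ ⁻¹' support (θ a) ⊆ R⁻¹ ⁻¹' B_r(x₁) = B_r(R x₁)`
  (`LinearIsometryEquiv.preimage_ball`);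
and `∫ (θ' t y)² dy = ∫ (θ t x)² dx` since `R⁻¹` preserves Lebesgue measure
(`LinearIsometryEquiv.measurePreserving`, `MeasurePreserving.integral_comp`). The forward
implication is the transfer lemma for `R`; the backward one is the transfer lemma for `R⁻¹` applied
to the conjugated drift, since `R⁻¹ ∘ (R ∘ u ∘ R⁻¹) ∘ R = u` and `R⁻¹ (R x₀) = x₀`.
-/

noncomputable section

open MeasureTheory Set Function
open scoped Laplacian InnerProductSpace RealInnerProductSpace

-- `Summit = Problem` for this summit; the tree lakefile sets `weak.linter.dupNamespace = false`.
set_option linter.dupNamespace false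

namespace Summit.NavierStokesRegularity.NavierStokesRegularity.Theorems

open Literature.Analysis.FluidPDE

/-- Change of variables under a linear isometry of `ℝ³`: `∫ g (R⁻¹ y) dy = ∫ g x dx`
(`R⁻¹` is measure preserving, `LinearIsometryEquiv.measurePreserving`). -/
theorem mixIsometry_integral_comp_symm
    (R : EuclideanSpace ℝ (Fin 3) ≃ₗᵢ[ℝ] EuclideanSpace ℝ (Fin 3))
    (g : EuclideanSpace ℝ (Fin 3) → ℝ) :
    ∫ y, g (R.symm y) = ∫ x, g x :=
  R.symm.measurePreserving.integral_comp R.symm.toHomeomorph.measurableEmbedding g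

/-- Supports under composition with a linear isometry: if `g` is supported in `B_r(x₁)` then
`g ∘ R⁻¹` is supported in `B_r(R x₁)` (`support (g ∘ R⁻¹) = R⁻¹ ⁻¹' support g` and
`R⁻¹ ⁻¹' B_r(x₁) = B_r(R x₁)`). -/
theorem mixIsometry_support_comp_symm_subset
    (R : EuclideanSpace ℝ (Fin 3) ≃ₗᵢ[ℝ] EuclideanSpace ℝ (Fin 3))
    {g : EuclideanSpace ℝ (Fin 3) → ℝ} {x₁ : EuclideanSpace ℝ (Fin 3)} {r : ℝ}
    (hg : Function.support g ⊆ Metric.ball x₁ r) :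
    Function.support (fun y => g (R.symm y)) ⊆ Metric.ball (R x₁) r := by
  intro y hy
  have hy' : R.symm y ∈ Metric.ball x₁ r := hg hy
  rw [Metric.mem_ball] at hy' ⊢
  rwa [← R.symm.dist_map y (R x₁), R.symm_apply_apply]

/-- The advection–diffusion equation is carried along a linear isometry: if `θ` solves
`∂ₜθ + ⟪v, ∇θ⟫ = Δθ` on `S × ℝ³` (time derivative within `S`), then `θ' t y := θ t (R⁻¹ y)`
solves `∂ₜθ' + ⟪R v R⁻¹, ∇θ'⟫ = Δθ'` there (`∇(θ ∘ R⁻¹) = R ∇θ ∘ R⁻¹`, `⟪R a, R b⟫ = ⟪a, b⟫`,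
`Δ(θ ∘ R⁻¹) = Δθ ∘ R⁻¹`). -/
theorem mixIsometry_equation_comp_symm
    (R : EuclideanSpace ℝ (Fin 3) ≃ₗᵢ[ℝ] EuclideanSpace ℝ (Fin 3)) {S : Set ℝ}
    {v : ℝ → EuclideanSpace ℝ (Fin 3) → EuclideanSpace ℝ (Fin 3)}
    {θ : ℝ → EuclideanSpace ℝ (Fin 3) → ℝ}
    (he : ∀ t ∈ S, ∀ x : EuclideanSpace ℝ (Fin 3),
      timeDerivWithin S θ t x + inner ℝ (v t x) (gradient (θ t) x) = Laplacian.laplacian (θ t) x) :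
    ∀ t ∈ S, ∀ y : EuclideanSpace ℝ (Fin 3),
      timeDerivWithin S (fun s z => θ s (R.symm z)) t y
          + inner ℝ (R (v t (R.symm y))) (gradient (fun z => θ t (R.symm z)) y)
        = Laplacian.laplacian (fun z => θ t (R.symm z)) y := by
  intro t ht y
  rw [timeDerivWithin_comp_linearIsometryEquiv_symm, gradient_comp_linearIsometryEquiv_symm,
    LinearIsometryEquiv.inner_map_map, laplacian_comp_linearIsometryEquiv_symm]
  exact he t ht (R.symm y)

/-- **Transfer lemma.** If the conjugated drift `(t, y) ↦ R (v t (R⁻¹ y))` dissipates at scale `r`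
with factor `δ` at `(T, R x₁)`, then `v` dissipates at scale `r` with factor `δ` at `(T, x₁)`:
every scalar `θ` admissible for `v` at `x₁` gives the scalar `θ ∘ R⁻¹` admissible for the
conjugated drift at `R x₁`, with the same `L²` masses at both ends of the window. At `r = 0`
both predicates hold outright (`dissipatesAtScale_zero_radius`). -/
theorem mixIsometry_of_conj
    (R : EuclideanSpace ℝ (Fin 3) ≃ₗᵢ[ℝ] EuclideanSpace ℝ (Fin 3))
    {v : ℝ → EuclideanSpace ℝ (Fin 3) → EuclideanSpace ℝ (Fin 3)} {T : ℝ}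
    {x₁ : EuclideanSpace ℝ (Fin 3)} {r δ : ℝ}
    (h : DissipatesAtScale (fun t y => R (v t (R.symm y))) T (R x₁) r δ) :
    DissipatesAtScale v T x₁ r δ := by
  rcases eq_or_ne r 0 with rfl | hr
  · exact dissipatesAtScale_zero_radius
  intro θ hs hd he hsupp
  have hS : UniqueDiffOn ℝ (Set.Icc (T - r ^ 2) (T - r ^ 2 / 2)) := by
    refine uniqueDiffOn_Icc ?_
    have hr2 : 0 < r ^ 2 := sq_pos_of_ne_zero hr
    linarith
  have key := h (fun s y => θ s (R.symm y)) (hs.comp_linearIsometryEquiv_symm R)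
    (HeatIsometry.hasUniformRapidDecayOn_comp_linearIsometryEquiv_symm R hd hS)
    (mixIsometry_equation_comp_symm R he) (mixIsometry_support_comp_symm_subset R hsupp)
  have i1 : ∫ y, (θ (T - r ^ 2 / 2) (R.symm y)) ^ 2 = ∫ x, (θ (T - r ^ 2 / 2) x) ^ 2 :=
    mixIsometry_integral_comp_symm R (fun x => (θ (T - r ^ 2 / 2) x) ^ 2)
  have i2 : ∫ y, (θ (T - r ^ 2) (R.symm y)) ^ 2 = ∫ x, (θ (T - r ^ 2) x) ^ 2 :=
    mixIsometry_integral_comp_symm R (fun x => (θ (T - r ^ 2) x) ^ 2)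
  rw [← i1, ← i2]
  exact key

/-- **INV2 — rotation/reflection covariance of the scalar dissipation factor** (registered
sub-goal `stub_dissipatesAtScale_isometry` of the crux `CoherentScaleExclusion`, line `registered`,
lead c3). For a linear isometry `R` of `ℝ³`, the conjugated drift `(t, y) ↦ R (u t (R⁻¹ y))`
dissipates at scale `r` with factor `δ` at `(T, R x₀)` iff `u` does at `(T, x₀)`: admissible
scalars are carried back and forth by `θ ↦ θ ∘ R^{∓1}` (`mixIsometry_of_conj` for `R` and for
`R⁻¹`), which preserves the class, the equation, the support condition and the `L²` masses. -/
theorem stub_dissipatesAtScale_isometry :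
    ∀ (R : EuclideanSpace ℝ (Fin 3) ≃ₗᵢ[ℝ] EuclideanSpace ℝ (Fin 3))
      (u : ℝ → EuclideanSpace ℝ (Fin 3) → EuclideanSpace ℝ (Fin 3)) (T : ℝ) (x₀ : EuclideanSpace ℝ (Fin 3))
      (r δ : ℝ),
      DissipatesAtScale (fun t y => R (u t (R.symm y))) T (R x₀) r δ ↔ DissipatesAtScale u T x₀ r δ := by
  intro R u T x₀ r δ
  refine ⟨mixIsometry_of_conj R, fun h => mixIsometry_of_conj R.symm ?_⟩
  simpa only [LinearIsometryEquiv.symm_symm, LinearIsometryEquiv.symm_apply_apply] using h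

end Summit.NavierStokesRegularity.NavierStokesRegularity.Theorems
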